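import Mathlib
import Summits.Ventures.HodgeRepro.Tier4.Line1.RTFSetting

/-!
# Tier4/Line1/TestIsolating — LINE L1, lemma J2.a `exists_test_isolating` (isolation by support)

Blind re-derivation cell `pub-hodge-repro`, Tier 4 «prove the step» (README §9–§10), seat t4-L1-p1 (prover, gen 0),
assignment t4-plan-1 S12221 (3) on LINE L1 (the RTF line; J2.a = the support rung of J2.c′ in Skeleton-v0.9.lean
L493–L504, generic Part I).  The docstring and statement are restated BYTE-IDENTICALLY from the skeleton inside
`namespace Summit.Ventures.HodgeRepro.Tier4.Line1.RTF.Setting` with `variable (S : Setting G)`, over the generic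
relative-trace-formula layer `Tier4/Line1/RTFSetting.lean` (imported by name).  No `sorry`; axioms = the trio.

THE MATHEMATICS.  Urysohn in the locally compact regular space `G` (Mathlib's
`exists_continuousMap_one_of_isCompact_subset_isOpen`) gives a continuous `g : G → [0, 1]` with `g γ₀ = 1` and
`tsupport g ⊆ U`; `f := g` viewed in `ℂ` is a test function with `tsupport f ⊆ U`.  `geoSupport f ⊆ {[γ₀]}`: a
contributing `γ` has `t⁻¹ γ t' ∈ support f ⊆ U` with `t ∈ DT ⊆ closure DT`, `t' ∈ DT' ⊆ closure DT'`, so `hiso`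
applies.  `[γ₀] ∈ geoSupport f`: the set `{(x, x') ∈ T × T' | f (x⁻¹ γ₀ x') ≠ 0}` is open and contains `(1, 1)`, so
it contains a product `N₁ × N₁'` of open neighbourhoods of `1`, of positive Haar measure (`IsOpenPosMeasure`); the
fundamental domains cover almost everywhere (`IsFundamentalDomain.ae_covers`), so there are `x ∈ N₁`, `x' ∈ N₁'` and
rational `δ ∈ T(k)`, `δ' ∈ T'(k)` with `t := δ x ∈ DT`, `t' := δ' x' ∈ DT'`; then `γ := δ γ₀ δ'⁻¹ ∈ G(k)` has
`[γ] = [γ₀]` (`DoubleCoset.eq`) and `t⁻¹ γ t' = x⁻¹ γ₀ x'`, where `f ≠ 0`.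

Setting fields used: `fdT`, `fdT'` (through `ae_covers`), `haarT`, `haarT'` (through `IsOpenPosMeasure`).
Nothing here says anything about the status of the Hodge conjecture for CM abelian varieties, which is NOT proved
(HC_CM is NOT proved by anyone in this repository).
-/

set_option autoImplicit false

noncomputable section

namespace Summit.Ventures.HodgeRepro.Tier4.Line1

open MeasureTheory Topology

namespace RTF

variable {G : Type} [Group G] [TopologicalSpace G] [IsTopologicalGroup G] [MeasurableSpace G]
  [BorelSpace G]

namespace Setting

variable (S : Setting G)

omit [BorelSpace G] in
/-- (J2.a, prover-facing, support, M): **isolation by support** — a bump at a rational `γ₀` with support in an open `U`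
that meets, on `closure DT × closure DT′`, no rational double coset but `[γ₀]` has geometric support exactly `{[γ₀]}`.
Proof plan: `exists_open_between_and_isCompact_closure` + `exists_continuous_one_zero_of_isCompact` (a topological
group is regular) give a test function `f` with `f γ₀ = 1` and `tsupport f ⊆ U`; `⊆` is `hiso` on
`subset_closure`; `∋`: `(1, 1)` need not lie in `DT × DT′`, but `f (x⁻¹ γ₀ x′) ≠ 0` on an open neighbourhood of
`(1, 1)`, which has positive Haar measure, so `fdT.ae_covers` / `fdT'.ae_covers` put `x = δ⁻¹ t`, `x′ = δ′⁻¹ t′` there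
with `t ∈ DT`, `t′ ∈ DT′`, `δ, δ′` rational, and `x⁻¹ γ₀ x′ = t⁻¹ (δ γ₀ δ′⁻¹) t′` with `[δ γ₀ δ′⁻¹] = [γ₀]`. -/
theorem exists_test_isolating [LocallyCompactSpace G] (γ₀ : S.Gk) {U : Set G} (hU : IsOpen U)
    (hγ : (γ₀ : G) ∈ U)
    (hiso : ∀ t ∈ closure S.DT, ∀ t' ∈ closure S.DT', ∀ γ : S.Gk,
      (t : G)⁻¹ * γ * t' ∈ U → S.orbitOf γ = S.orbitOf γ₀) :
    ∃ f : G → ℂ, IsTest f ∧ tsupport f ⊆ U ∧ S.geoSupport f = {S.orbitOf γ₀} := by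
  -- the bump at `γ₀` with `tsupport ⊆ U` (Urysohn in the locally compact regular space `G`)
  obtain ⟨g, hg1, hgc, hgU, -⟩ :=
    exists_continuousMap_one_of_isCompact_subset_isOpen isCompact_singleton hU
      (Set.singleton_subset_iff.mpr hγ)
  have hfc : Continuous fun x : G => ((g x : ℝ) : ℂ) := Complex.continuous_ofReal.comp g.continuous
  have hgcs : HasCompactSupport (⇑g) := hgc
  have hfcs : HasCompactSupport fun x : G => ((g x : ℝ) : ℂ) := hgcs.comp_left Complex.ofReal_zero
  have hfsupp : tsupport (fun x : G => ((g x : ℝ) : ℂ)) ⊆ U :=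
    (tsupport_comp_subset Complex.ofReal_zero (⇑g)).trans hgU
  refine ⟨fun x : G => ((g x : ℝ) : ℂ), ⟨hfc, hfcs⟩, hfsupp, Set.Subset.antisymm ?_ ?_⟩
  · -- `⊆`: every contributing double coset is `[γ₀]`, by `hiso` on `subset_closure`
    rintro o ⟨t, ht, t', ht', γ, rfl, hne⟩
    exact hiso t (subset_closure ht) t' (subset_closure ht') γ
      (hfsupp (subset_tsupport _ hne))
  · -- `∋`: a neighbourhood of `(1, 1)` in `T × T'` on which `f (x⁻¹ γ₀ x') ≠ 0`, of positive Haar measure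
    rw [Set.singleton_subset_iff]
    have hV : IsOpen (Function.support fun x : G => ((g x : ℝ) : ℂ)) := hfc.isOpen_support
    have hγV : (γ₀ : G) ∈ Function.support fun x : G => ((g x : ℝ) : ℂ) := by
      rw [Function.mem_support]
      simp [hg1 (Set.mem_singleton _)]
    have hm : Continuous fun p : S.T × S.T' => (p.1 : G)⁻¹ * γ₀ * (p.2 : G) :=
      ((continuous_subtype_val.comp continuous_fst).inv.mul continuous_const).mul
        (continuous_subtype_val.comp continuous_snd)
    have h11 : ((1 : S.T), (1 : S.T')) ∈
        (fun p : S.T × S.T' => (p.1 : G)⁻¹ * γ₀ * (p.2 : G)) ⁻¹'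
          Function.support fun x : G => ((g x : ℝ) : ℂ) := by
      simpa using hγV
    obtain ⟨N₁, N₁', hN₁, hN₁', h1N₁, h1N₁', hNsub⟩ :=
      isOpen_prod_iff.mp (hV.preimage hm) 1 1 h11
    haveI : S.μT.IsHaarMeasure := S.haarT
    haveI : S.μT'.IsHaarMeasure := S.haarT'
    obtain ⟨x, hxN, δ, hδx⟩ := MeasureTheory.Measure.exists_mem_of_measure_ne_zero_of_ae
      (hN₁.measure_ne_zero S.μT ⟨1, h1N₁⟩) (MeasureTheory.ae_restrict_of_ae S.fdT.ae_covers)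
    obtain ⟨x', hxN', δ', hδx'⟩ := MeasureTheory.Measure.exists_mem_of_measure_ne_zero_of_ae
      (hN₁'.measure_ne_zero S.μT' ⟨1, h1N₁'⟩) (MeasureTheory.ae_restrict_of_ae S.fdT'.ae_covers)
    have hδG : ((δ : S.T) : G) ∈ S.Gk := Subgroup.mem_subgroupOf.mp δ.2
    have hδ'G : ((δ' : S.T') : G) ∈ S.Gk := Subgroup.mem_subgroupOf.mp δ'.2
    have hxx : (x, x') ∈ (fun p : S.T × S.T' => (p.1 : G)⁻¹ * γ₀ * (p.2 : G)) ⁻¹'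
        Function.support fun x : G => ((g x : ℝ) : ℂ) := hNsub ⟨hxN, hxN'⟩
    refine ⟨δ • x, hδx, δ' • x', hδx', ⟨_, hδG⟩ * γ₀ * (⟨_, hδ'G⟩ : S.Gk)⁻¹, ?_, ?_⟩
    · -- `[δ γ₀ δ'⁻¹] = [γ₀]`
      show DoubleCoset.mk S.Tk S.T'k _ = DoubleCoset.mk S.Tk S.T'k γ₀
      symm
      rw [DoubleCoset.eq]
      exact ⟨⟨_, hδG⟩, Subgroup.mem_subgroupOf.mpr (δ : S.T).2,
        (⟨_, hδ'G⟩ : S.Gk)⁻¹, Subgroup.mem_subgroupOf.mpr (inv_mem (δ' : S.T').2), rfl⟩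
    · -- `(δ x)⁻¹ (δ γ₀ δ'⁻¹) (δ' x') = x⁻¹ γ₀ x'`, where `f ≠ 0`
      have key : ((δ • x : S.T) : G)⁻¹ * ((⟨_, hδG⟩ * γ₀ * (⟨_, hδ'G⟩ : S.Gk)⁻¹ : S.Gk) : G) *
          ((δ' • x' : S.T') : G) = (x : G)⁻¹ * γ₀ * (x' : G) := by
        simp only [Subgroup.smul_def, smul_eq_mul, Subgroup.coe_mul, Subgroup.coe_inv]
        group
      show (fun x : G => ((g x : ℝ) : ℂ)) _ ≠ 0
      rw [key]
      exact hxx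

end Setting

end RTF

end Summit.Ventures.HodgeRepro.Tier4.Line1
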